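import Literature.AlgebraicGeometry.HodgeTheory.QuaternionicQuarticFamilyDeckBirationalHolds
import HarnessLib

/-!
# Route `Q8SymplecticPowers`, crux K1Q «mechanism-v5» — glue S7, brick G8: the fibre of a family carrying the deck clauses of S6 over a
# complex point `t` with `G_e(a(t)) ≠ 0` is birational over `ℂ` to every hypersurface cut out by the quaternionic quartic form of `a(t)`

Support file for crux K1Q (stmt-HodgeConjecture-24190; `--supports … --as helper`; nothing here closes an item). Prover seat
`hodge-nonav-19716-p2` (g14), owner of stub S7 `stub_transportHeredityQ`. S7 receives the family model only through the BODY of S6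
(`Q8FamilyDeck e` unfolded: smooth projective family `π : 𝒳 ⟶ base W`, deck pair, the equivariant open immersion `ι` of the étale deck
chart over `W`, surjective onto `W`) — WITHOUT prover-Bx's birationality clause (iii). This file re-derives (iii) from those clauses at
every point `t ∈ W(ℂ)` whose coefficient vector `a = coeffs W t` has `G_e(a) ≠ 0` (`genericityElem`), following prover-Bx's
`q8FamilyDeck_birational` step for step (the only use of his `W ⊆ D(G_e)` there is `G_e(a) ≠ 0`, taken here as a hypothesis):
`𝒳_t` is irreducible and contains the non-empty open `𝒰_t ≅ Spec (DeckRing X_a)` (base change of `ι`; `deckChartTensorLeftIso`),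
`Spec (DeckRing X_a) ~bir 𝒱_a` (`birationalOver_deckChart_fiberSch`, M1-1 CHART-IN-COVER) and `𝒱_a ≅ V`
(`nonempty_iso_of_isHypersurfaceCutOutBy_quarticForm`, C3).

* `birationalOver_fiberOver_of_deckClauses` — the statement above (hypothesis hbir_t of the S7 telescope).

HONEST FRAMING: bookkeeping over tree theorems (axioms standard, no named fact); K1Q ∕ HC ∕ HC_AV NOT proved; item 24190 OPEN.

## References
* [Hartshorne1977] R. Hartshorne, Algebraic Geometry (1977), I Example 1.1.3, II Example 3.2.6.
* [GortzWedhorn2020] U. Görtz, T. Wedhorn, Algebraic Geometry I (2nd ed.), Prop. 4.32 (2).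
-/

noncomputable section

set_option linter.dupNamespace false

open CategoryTheory CategoryTheory.Limits AlgebraicGeometry TopologicalSpace MvPolynomial
  MonoidalCategory CartesianMonoidalCategory
open Literature.AlgebraicGeometry.Morphisms Literature.AlgebraicGeometry.Motives
open Literature.AlgebraicGeometry.HodgeTheory Literature.AlgebraicGeometry.HodgeTheory.Q8Family
open Literature.AlgebraicGeometry.RelativeSpec

namespace Summit.HodgeConjecture.HodgeConjecture.Theorems.Q8SymplecticPowersFibreBirational

set_option backward.isDefEq.respectTransparency false

/-- **G8: the fibre over `t` of a family with the S6 deck clauses is birational to every `V_(c,ψ)` of the coefficient vector of `t`,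
provided `G_e(a(t)) ≠ 0`** (prover-Bx's clause (iii), from the clauses; see the module docstring).
[cite: Hartshorne1977, I Example 1.1.3] [cite: GortzWedhorn2020, Prop. 4.32 (2)] -/
theorem birationalOver_fiberOver_of_deckClauses {e : ℕ} (he : 1 ≤ e) (W : (Spec (.of (ParamRing e))).Opens) (𝒳 : SchemeOver ℂ)
    (π : 𝒳 ⟶ base W) (ι : (deckChart (fun i => (MvPolynomial.X i : ParamRing e)) ⊗ Over.mk W.ι).left ⟶ 𝒳.left)
    (hπ : IsSmoothProjectiveFamily π 2) (hιo : IsOpenImmersion ι)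
    (hιπ : ι ≫ π.left = (snd (deckChart (fun i => (MvPolynomial.X i : ParamRing e))) (Over.mk W.ι)).left)
    (hsurj : Function.Surjective (snd (deckChart (fun i => (MvPolynomial.X i : ParamRing e))) (Over.mk W.ι)).left)
    (t : ComplexPoints (base W)) (hGe : MvPolynomial.eval (coeffs W t) (genericityElem e) ≠ 0)
    ⦃V : SchemeOver ℂ⦄ (hV : IsHypersurfaceCutOutBy 3 (quarticForm e (cOf (coeffs W t)) (ψOf (coeffs W t))) V) :
    Scheme.BirationalOver (fiberOver π t).hom V.hom := by
  classical
  haveI := hιo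
  let U : SchemeOver (ParamRing e) := deckChart (fun i => (MvPolynomial.X i : ParamRing e))
  let Wo : SchemeOver (ParamRing e) := Over.mk W.ι
  let a : CIdx e → ℂ := coeffs W t
  let φ : ParamRing e →+* ℂ := MvPolynomial.eval a
  -- ### (1) the point `t` as `Spec ℂ → Spec A`: `eval a`
  have hpt : t.left ≫ W.ι = Spec.map (CommRingCat.ofHom φ) := by
    have hSpec : Spec.map (Spec.preimage (t.left ≫ W.ι)) = t.left ≫ W.ι := Spec.map_preimage _
    have hcomp : (Spec.preimage (t.left ≫ W.ι)).hom.comp (algebraMap ℂ (MvPolynomial (CIdx e) ℂ)) =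
        algebraMap ℂ ℂ := by
      have hw : Spec.map (Spec.preimage (t.left ≫ W.ι)) ≫
          Spec.map (CommRingCat.ofHom (algebraMap ℂ (MvPolynomial (CIdx e) ℂ))) =
            Spec.map (CommRingCat.ofHom (algebraMap ℂ ℂ)) := by
        rw [hSpec]
        exact (Category.assoc _ _ _).trans (Over.w t)
      rw [← Spec.map_comp] at hw
      have := congrArg CommRingCat.Hom.hom (Spec.map_injective hw)
      simpa using this
    have hφ : (Spec.preimage (t.left ≫ W.ι)).hom = φ := by
      refine MvPolynomial.ringHom_ext (fun r => ?_) (fun i => ?_)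
      · change _ = MvPolynomial.eval a (MvPolynomial.C r)
        rw [MvPolynomial.eval_C, ← MvPolynomial.algebraMap_eq]
        simpa using RingHom.congr_fun hcomp r
      · change _ = MvPolynomial.eval a (MvPolynomial.X i)
        rw [MvPolynomial.eval_X]
        rfl
    rw [← hφ, CommRingCat.ofHom_hom, hSpec]
  let x₀ : Spec (.of ℂ) := ⟨⊥, Ideal.isPrime_bot⟩
  have hGa : φ (genericityElem e) ≠ 0 := hGe
  -- ### (2) the fibre `𝒳_t` is irreducible
  have hXt : IsSmoothProjective 2 (fiberOver π t) := hπ.isSmoothProjective t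
  haveI : GeometricallyIrreducible (fiberOver π t).hom := hXt.geometricallyIrreducible
  haveI : Subsingleton ↥(Spec (CommRingCat.of ℂ)) := inferInstanceAs (Subsingleton (PrimeSpectrum ℂ))
  haveI : IrreducibleSpace ↥(fiberOver π t).left :=
    GeometricallyIrreducible.irreducibleSpace_of_subsingleton (f := (fiberOver π t).hom)
  haveI : IrreducibleSpace ↥(pullback π.left t.left) := ‹IrreducibleSpace ↥(fiberOver π t).left›
  have h3' : (specOver ℂ ℂ).hom = 𝟙 _ := by
    change Spec.map (CommRingCat.ofHom (RingHom.id ℂ)) = _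
    exact Spec.map_id _
  have h4' : (fiberOver π t).hom = pullback.snd π.left t.left := by
    rw [fiberOver_hom, h3']
    exact Category.comp_id _
  -- ### (3) the chart fibre `𝒰_t` inside `𝒳_t`: a non-empty (dense) open
  let Ut : Scheme := pullback (snd U Wo).left t.left
  let ιt : Ut ⟶ pullback π.left t.left :=
    pullback.map (snd U Wo).left t.left π.left t.left ι (𝟙 _) (𝟙 _)
      (by rw [Category.comp_id]; exact hιπ.symm) (by rw [Category.comp_id, Category.id_comp])
  have hιt_fst : ιt ≫ pullback.fst π.left t.left = pullback.fst (snd U Wo).left t.left ≫ ι := pullback.lift_fst _ _ _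
  have hιt_snd : ιt ≫ pullback.snd π.left t.left = pullback.snd (snd U Wo).left t.left := by
    rw [pullback.lift_snd]
    exact Category.comp_id _
  have sq : IsPullback ιt (pullback.fst (snd U Wo).left t.left) (pullback.fst π.left t.left) ι := by
    refine IsPullback.of_right (h₁₂ := pullback.snd π.left t.left) (v₁₃ := t.left) (h₂₂ := π.left) ?_ hιt_fst
      (IsPullback.of_hasPullback π.left t.left).flip
    rw [hιt_snd, hιπ]
    exact (IsPullback.of_hasPullback (snd U Wo).left t.left).flip
  haveI : IsOpenImmersion ιt := MorphismProperty.of_isPullback sq.flip hιo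
  haveI : Nonempty ↥Ut := by
    obtain ⟨u, hu⟩ := hsurj (t.left x₀)
    obtain ⟨z, -, -⟩ := Scheme.Pullback.exists_preimage_pullback u x₀ hu
    exact ⟨z⟩
  haveI : IsDominant ιt := ⟨ιt.isOpenEmbedding.isOpen_range.dense (Set.range_nonempty _)⟩
  have b1 : Scheme.BirationalOver (pullback.snd (snd U Wo).left t.left) (pullback.snd π.left t.left) :=
    Scheme.Hom.birationalOver ιt _ _ hιt_snd
  -- ### (4) `𝒰_t ≅ Spec (DeckRing X_a)` over `Spec ℂ`
  letI alg : Algebra (ParamRing e) ℂ := φ.toAlgebra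
  have hpt' : t.left ≫ W.ι = (specOver (ParamRing e) ℂ).hom := hpt
  let i₁ : Ut ≅ pullback U.hom (t.left ≫ W.ι) := pullbackLeftPullbackSndIso U.hom W.ι t.left
  let i₂ : pullback U.hom (t.left ≫ W.ι) ≅ (U ⊗ specOver (ParamRing e) ℂ).left := pullback.congrHom rfl hpt'
  let i₃ : (U ⊗ specOver (ParamRing e) ℂ).left ≅
      Spec (.of (DeckRing (algebraMap (ParamRing e) ℂ ∘ fun i => (MvPolynomial.X i : ParamRing e)))) :=
    deckChartTensorLeftIso ℂ (fun i => (MvPolynomial.X i : ParamRing e))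
  let sD : Spec (.of (DeckRing (algebraMap (ParamRing e) ℂ ∘ fun i => (MvPolynomial.X i : ParamRing e)))) ⟶
      Spec (.of ℂ) :=
    Spec.map (CommRingCat.ofHom (algebraMap ℂ (DeckRing (algebraMap (ParamRing e) ℂ ∘ fun i =>
      (MvPolynomial.X i : ParamRing e)))))
  have hi₃ : i₃.hom ≫ sD = (snd U (specOver (ParamRing e) ℂ)).left :=
    deckChartTensorLeftIso_hom_comp_specMap ℂ (fun i => (MvPolynomial.X i : ParamRing e))
  have hi₂ : i₂.hom ≫ (snd U (specOver (ParamRing e) ℂ)).left = pullback.snd U.hom (t.left ≫ W.ι) := by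
    change (pullback.congrHom rfl hpt').hom ≫ pullback.snd _ _ = _
    rw [pullback.congrHom_hom, pullback.lift_snd, Category.comp_id]
  have hi₁ : i₁.hom ≫ pullback.snd U.hom (t.left ≫ W.ι) = pullback.snd (snd U Wo).left t.left :=
    pullbackLeftPullbackSndIso_hom_snd _ _ _
  let eU : Ut ≅ Spec (.of (DeckRing (algebraMap (ParamRing e) ℂ ∘ fun i => (MvPolynomial.X i : ParamRing e)))) :=
    i₁ ≪≫ i₂ ≪≫ i₃
  have heU : eU.hom ≫ sD = pullback.snd (snd U Wo).left t.left := by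
    change (i₁.hom ≫ i₂.hom ≫ i₃.hom) ≫ sD = _
    rw [Category.assoc, Category.assoc, hi₃, hi₂, hi₁]
  have b2 : Scheme.BirationalOver (pullback.snd (snd U Wo).left t.left) sD :=
    Scheme.Hom.birationalOver eU.hom _ _ heU
  -- ### (5) `Spec (DeckRing X_a) ~bir 𝒱_a` (M1-1 fibrewise) — the chart is non-empty
  haveI : Nontrivial (DeckRing (algebraMap (ParamRing e) ℂ ∘ fun i => (MvPolynomial.X i : ParamRing e))) := by
    obtain ⟨z⟩ := ‹Nonempty ↥Ut›
    let y := eU.hom z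
    refine nontrivial_of_ne 1 0 fun h10 => y.2.ne_top ?_
    rw [Ideal.eq_top_iff_one, h10]
    exact zero_mem _
  have b3 : Scheme.BirationalOver sD (fiberSch e (algebraMap (ParamRing e) ℂ)).hom :=
    birationalOver_deckChart_fiberSch e he hGa
  -- ### (6) `𝒱_a ≅ V` (C3)
  have ha : (fun i => φ (MvPolynomial.X i)) = a := funext fun i => MvPolynomial.eval_X _
  have hV' : IsHypersurfaceCutOutBy 3 (quarticForm e (cOf fun i => φ (MvPolynomial.X i)) (ψOf fun i => φ (MvPolynomial.X i))) V := by
    rw [ha]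
    exact hV
  obtain ⟨eV⟩ := nonempty_iso_of_isHypersurfaceCutOutBy_quarticForm e φ he hGa hV'
  haveI : IsIso eV.hom.left := (inferInstance : IsIso ((Over.forget _).mapIso eV).hom)
  have b4 : Scheme.BirationalOver (fiberSch e (algebraMap (ParamRing e) ℂ)).hom V.hom :=
    (Scheme.Hom.birationalOver eV.hom.left V.hom (fiberSch e φ).hom (Over.w eV.hom)).symm.symm
  -- ### (7) compose
  rw [h4']
  exact b1.symm.trans (b2.trans (b3.trans b4))

end Summit.HodgeConjecture.HodgeConjecture.Theorems.Q8SymplecticPowersFibreBirational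

end
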